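import Summits.HodgeConjecture.CorCM.GaloisCyclicSemidirectEightTwoSheet
import HarnessLib

/-!
# The group `C_p ⋊ C_{2^{a+2}}` and the norm form of odd character sums on `ℤ/2^{a+1} × ℤ/p`

COR-CM (cell `pub-hodgecm2`), binder seat b04 (gen 25), count-neutral claim CYCLIC-SEMIDIRECT-TWO-POWER, part Ia — the
`2^{a+2}`-analogue of §§1–2 of `CorCM/GaloisCyclicSemidirectEightTwoSheet` (`a = 1`): the Galois group
`G₀ = C_p ⋊ C_{2^{a+2}} = ⟨u, y | u^p = y^{2^{a+2}} = 1, y u y⁻¹ = u⁻¹⟩` (Mathlib model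
`Multiplicative (ZMod p) ⋊[φ] Multiplicative (ZMod (2^(a+2)))`, `φ(1)` = inversion; order `2^{a+2} p`, unique involution
`y^{2^{a+1}} = inr 2^{a+1}`), its index-`2` abelian subgroup `A = ⟨y²⟩ × ⟨u⟩ ≅ ℤ/2^{a+1} × ℤ/p` (cyclic, generator `(1,1)`),
and the NORM FORM of odd character sums: for a ring map `ρ` out of a subfield `M ⊇ μ_{2^{a+1}p}` of `ℂ` fixing `μ_{2^{a+1}}`
and inverting `μ_p`, `χ(t, v⁻¹) = ρ(χ(t, v))` element by element, so `Ŝ(χθ) = ρ(Ŝ(χ))` and a vanishing two-sheet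
determinant `Ŝ₁ρ(Ŝ₁) − ω Ŝ₂ρ(Ŝ₂)` (`ω^{2^a} = −1`) kills both sheet sums under the hypothesis `hN` («`ω` is not a quotient
of norms»).  The model theorem is part Ib (`CorCM/GaloisCyclicSemidirectTwoPowerTwoSheet`).  KERNEL ONLY: theorems; no
definition, no named fact, no `sorry`.  `HC_CM` is neither used nor claimed.

* §1 `orderOf_gamma`, `mem_powers_gamma`, `pow_omega`.
* §2 `character_normForm`, `sum_character_normForm`, **`sums_eq_zero_of_det_eq_zero`**.
* §3 `phi_two_pow`, `eq_zero_or_eq_of_add_self`, **`involution_eq`**, `card_eq` (`eq_one_of_mul_self` is reused from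
  `CorCM/GaloisCyclicSemidirectEightTwoSheet`).

## References

* [Kubota1965] T. Kubota, Nagoya Math. J. 25 (1965) 113–120, §4 Lemma 2.
* [Dodson1984] B. Dodson, Trans. AMS 283 (1984) 1–32, §5.3.
-/
noncomputable section

open scoped BigOperators

namespace Summit.HodgeConjecture.CorCM.GaloisCyclicSemidirectTwoPower

open Literature.NumberTheory.ComplexMultiplication (IsCMTypeWith)
open Summit.HodgeConjecture.CorCM.CyclicTwoPower (mul_pow_mem_iff_of_sum_eq_zero)
open AddChar

/-! ## §1 The cyclic group `ℤ/2^{a+1} × ℤ/p` -/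

section Cyclic

variable {p a : ℕ} [Fact p.Prime]

/-- `(1, 1)` has order `2^{a+1} p` in `ℤ/2^{a+1} × ℤ/p` (`p` odd). [folklore] -/
theorem orderOf_gamma (hp2 : p ≠ 2) :
    orderOf ((Multiplicative.ofAdd (1 : ZMod (2 ^ (a + 1))), Multiplicative.ofAdd (1 : ZMod p)) :
      Multiplicative (ZMod (2 ^ (a + 1))) × Multiplicative (ZMod p)) = 2 ^ (a + 1) * p := by
  have hp : p.Prime := Fact.out
  rw [Prod.orderOf_mk, orderOf_ofAdd_eq_addOrderOf, orderOf_ofAdd_eq_addOrderOf, ZMod.addOrderOf_one,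
    ZMod.addOrderOf_one]
  have hcop : Nat.Coprime (2 ^ (a + 1)) p :=
    Nat.Coprime.pow_left _ ((Nat.coprime_primes Nat.prime_two hp).2 (Ne.symm hp2))
  rw [hcop.lcm_eq_mul]

/-- Every element of `ℤ/2^{a+1} × ℤ/p` is a power of `(1, 1)`. [folklore] -/
theorem mem_powers_gamma (hp2 : p ≠ 2) (w : Multiplicative (ZMod (2 ^ (a + 1))) × Multiplicative (ZMod p)) :
    w ∈ Submonoid.powers ((Multiplicative.ofAdd (1 : ZMod (2 ^ (a + 1))), Multiplicative.ofAdd (1 : ZMod p)) :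
      Multiplicative (ZMod (2 ^ (a + 1))) × Multiplicative (ZMod p)) := by
  have hp : p.Prime := Fact.out
  haveI : NeZero p := ⟨hp.ne_zero⟩
  have htop : Subgroup.zpowers ((Multiplicative.ofAdd (1 : ZMod (2 ^ (a + 1))), Multiplicative.ofAdd (1 : ZMod p)) :
      Multiplicative (ZMod (2 ^ (a + 1))) × Multiplicative (ZMod p)) = ⊤ := by
    apply Subgroup.eq_top_of_card_eq
    rw [Nat.card_zpowers, orderOf_gamma hp2, Nat.card_eq_fintype_card, Fintype.card_prod,
      Fintype.card_multiplicative, Fintype.card_multiplicative, ZMod.card, ZMod.card]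
  rw [mem_powers_iff_mem_zpowers, htop]
  exact Subgroup.mem_top w

end Cyclic

section Omega

variable {p a : ℕ}

/-- For an ODD character `χ` (`χ(2^a, 0) = -1`), `ω = χ(1, 0)` has `ω^{2^a} = -1`. [folklore] -/
theorem pow_omega (χ : AddChar (Additive (Multiplicative (ZMod (2 ^ (a + 1))) × Multiplicative (ZMod p))) ℂ)
    (hχ : χ (Additive.ofMul (Multiplicative.ofAdd ((2 ^ a : ℕ) : ZMod (2 ^ (a + 1))), (1 : Multiplicative (ZMod p)))) = -1) :
    χ (Additive.ofMul (Multiplicative.ofAdd (1 : ZMod (2 ^ (a + 1))), (1 : Multiplicative (ZMod p)))) ^ 2 ^ a = -1 := by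
  rw [← map_nsmul_eq_pow, ← ofMul_pow, Prod.pow_mk, one_pow, ← ofAdd_nsmul, nsmul_eq_mul, mul_one, ← hχ]

end Omega

/-! ## §2 Norm forms through an auxiliary embedding `ρ` -/

section NormForm

variable {p a : ℕ}
variable (χ : AddChar (Additive (Multiplicative (ZMod (2 ^ (a + 1))) × Multiplicative (ZMod p))) ℂ)
variable (M : Subfield ℂ) (ρ : M →+* ℂ) (hM : ∀ z : ℂ, z ^ (2 ^ (a + 1) * p) = 1 → z ∈ M)
  (hρ2 : ∀ z : M, (z : ℂ) ^ 2 ^ (a + 1) = 1 → ρ z = z) (hρp : ∀ z : M, (z : ℂ) ^ p = 1 → ρ z = (z : ℂ)⁻¹)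
include hM hρ2 hρp

/-- **The norm form, one element at a time**: `χ(t, v) ∈ M` and `ρ(χ(t, v)) = χ(t, v⁻¹)`. [folklore] -/
theorem character_normForm (w : Multiplicative (ZMod (2 ^ (a + 1))) × Multiplicative (ZMod p)) :
    ∃ m : M, (m : ℂ) = χ (Additive.ofMul w) ∧ ρ m = χ (Additive.ofMul (w.1, w.2⁻¹)) := by
  obtain ⟨t, v⟩ := w
  set ψ : ℂ := χ (Additive.ofMul (t, (1 : Multiplicative (ZMod p)))) with hψ_def
  set ℓ : ℂ := χ (Additive.ofMul ((1 : Multiplicative (ZMod (2 ^ (a + 1)))), v)) with hℓ_def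
  have hψ2 : ψ ^ 2 ^ (a + 1) = 1 := by
    rw [hψ_def, ← map_nsmul_eq_pow, ← ofMul_pow, Prod.pow_mk, one_pow]
    have ht : t ^ 2 ^ (a + 1) = 1 := by
      rw [← ofAdd_toAdd t, ← ofAdd_nsmul, nsmul_eq_mul, show ((2 ^ (a + 1) : ℕ) : ZMod (2 ^ (a + 1))) = 0 from
        ZMod.natCast_self _, zero_mul]; rfl
    rw [ht, ← Prod.one_eq_mk, ofMul_one, map_zero_eq_one]
  have hℓp : ℓ ^ p = 1 := by
    rw [hℓ_def, ← map_nsmul_eq_pow, ← ofMul_pow, Prod.pow_mk, one_pow]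
    have hv : v ^ p = 1 := by
      rw [← ofAdd_toAdd v, ← ofAdd_nsmul, nsmul_eq_mul, ZMod.natCast_self, zero_mul]; rfl
    rw [hv, ← Prod.one_eq_mk, ofMul_one, map_zero_eq_one]
  have hψM : ψ ∈ M := hM ψ (by rw [pow_mul, hψ2, one_pow])
  have hℓM : ℓ ∈ M := hM ℓ (by rw [mul_comm, pow_mul, hℓp, one_pow])
  have hsplit : χ (Additive.ofMul (t, v)) = ψ * ℓ := by
    rw [hψ_def, hℓ_def, ← map_add_eq_mul, ← ofMul_mul, Prod.mk_mul_mk, mul_one, one_mul]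
  have hsplit' : χ (Additive.ofMul (t, v⁻¹)) = ψ * ℓ⁻¹ := by
    rw [hψ_def, hℓ_def, ← map_neg_eq_inv, ← ofMul_inv, Prod.inv_mk, inv_one, ← map_add_eq_mul, ← ofMul_mul,
      Prod.mk_mul_mk, mul_one, one_mul]
  refine ⟨⟨ψ, hψM⟩ * ⟨ℓ, hℓM⟩, ?_, ?_⟩
  · rw [hsplit]; rfl
  · rw [map_mul, hρ2 ⟨ψ, hψM⟩ hψ2, hρp ⟨ℓ, hℓM⟩ hℓp, hsplit']

/-- **The norm form of a character sum**: `Σ_T χ ∈ M` and `ρ(Σ_T χ) = Σ_T χ∘θ`. [cite: Kubota1965, §4 Lemma 2] -/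
theorem sum_character_normForm (T : Finset (Multiplicative (ZMod (2 ^ (a + 1))) × Multiplicative (ZMod p))) :
    ∃ m : M, (m : ℂ) = ∑ w ∈ T, χ (Additive.ofMul w) ∧ ρ m = ∑ w ∈ T, χ (Additive.ofMul (w.1, w.2⁻¹)) := by
  choose m hm hρm using character_normForm χ M ρ hM hρ2 hρp
  refine ⟨∑ w ∈ T, m w, ?_, ?_⟩
  · rw [show (((∑ w ∈ T, m w : M)) : ℂ) = ∑ w ∈ T, (m w : ℂ) from map_sum M.subtype _ _]
    exact Finset.sum_congr rfl fun w _ => hm w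
  · rw [map_sum]
    exact Finset.sum_congr rfl fun w _ => hρm w

/-- **`Δ(χ) = 0` kills both sheet sums** when `ω = χ(1, 0)` is not a quotient of norms `z ρ(z)`.
[cite: Kubota1965, §4 Lemma 2] -/
theorem sums_eq_zero_of_det_eq_zero
    (hN : ∀ (z₁ z₂ : M) (ω : ℂ), ω ^ 2 ^ a = -1 → (z₁ : ℂ) * ρ z₁ = ω * ((z₂ : ℂ) * ρ z₂) →
      (z₁ : ℂ) = 0 ∧ (z₂ : ℂ) = 0)
    (hχ : χ (Additive.ofMul (Multiplicative.ofAdd ((2 ^ a : ℕ) : ZMod (2 ^ (a + 1))), (1 : Multiplicative (ZMod p)))) = -1)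
    (S₁ S₂ : Finset (Multiplicative (ZMod (2 ^ (a + 1))) × Multiplicative (ZMod p)))
    (hΔ : (∑ s ∈ S₁, χ (Additive.ofMul s)) * (∑ s ∈ S₁, χ (Additive.ofMul (s.1, s.2⁻¹))) -
      χ (Additive.ofMul (Multiplicative.ofAdd (1 : ZMod (2 ^ (a + 1))), (1 : Multiplicative (ZMod p)))) *
        ((∑ t ∈ S₂, χ (Additive.ofMul t)) * (∑ t ∈ S₂, χ (Additive.ofMul (t.1, t.2⁻¹)))) = 0) :
    ∑ s ∈ S₁, χ (Additive.ofMul s) = 0 ∧ ∑ t ∈ S₂, χ (Additive.ofMul t) = 0 := by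
  obtain ⟨m₁, h1, h1θ⟩ := sum_character_normForm χ M ρ hM hρ2 hρp S₁
  obtain ⟨m₂, h2, h2θ⟩ := sum_character_normForm χ M ρ hM hρ2 hρp S₂
  have hω := pow_omega χ hχ
  rw [← h1, ← h1θ, ← h2, ← h2θ] at hΔ
  obtain ⟨hz₁, hz₂⟩ := hN m₁ m₂ _ hω (by linear_combination hΔ)
  rw [← h1, ← h2, hz₁, hz₂]
  exact ⟨rfl, rfl⟩

end NormForm

/-! ## §3 The group `C_p ⋊ C_{2^{a+2}}` -/

section Group

variable {p a : ℕ}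
variable (φ : Multiplicative (ZMod (2 ^ (a + 2))) →* MulAut (Multiplicative (ZMod p)))
  (hφ : ∀ v : Multiplicative (ZMod p), φ (Multiplicative.ofAdd 1) v = v⁻¹)
include hφ

/-- The action: `φ(m) = inversion^{m}`; in particular `φ(2)^k = 1`. [folklore] -/
theorem phi_two_pow (k : ℕ) (v : Multiplicative (ZMod p)) :
    φ (Multiplicative.ofAdd (2 : ZMod (2 ^ (a + 2))) ^ k) v = v := by
  have h2 : ∀ w : Multiplicative (ZMod p), φ (Multiplicative.ofAdd (2 : ZMod (2 ^ (a + 2)))) w = w := fun w => by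
    rw [show (2 : ZMod (2 ^ (a + 2))) = 1 + 1 by norm_num, ofAdd_add, map_mul, MulAut.mul_apply, hφ, hφ, inv_inv]
  induction k generalizing v with
  | zero => rw [pow_zero, map_one, MulAut.one_apply]
  | succ k ih => rw [pow_succ (Multiplicative.ofAdd (2 : ZMod (2 ^ (a + 2)))) k, map_mul, MulAut.mul_apply, h2, ih]

omit hφ in
/-- `m + m = 0` in `ℤ/2^{a+2}` forces `m ∈ {0, 2^{a+1}}`. [folklore] -/
theorem eq_zero_or_eq_of_add_self (m : ZMod (2 ^ (a + 2))) (hm : m + m = 0) :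
    m = 0 ∨ m = ((2 ^ (a + 1) : ℕ) : ZMod (2 ^ (a + 2))) := by
  haveI : NeZero (2 ^ (a + 2)) := ⟨by positivity⟩
  have hv := ZMod.val_lt m
  have h2 : (2 : ℕ) ^ (a + 2) = 2 * 2 ^ (a + 1) := by rw [pow_succ]; ring
  have hdvd : 2 ^ (a + 2) ∣ 2 * m.val := by
    rw [← ZMod.natCast_eq_zero_iff, Nat.cast_mul, ZMod.natCast_zmod_val, Nat.cast_ofNat, two_mul, hm]
  have hdvd' : 2 * 2 ^ (a + 1) ∣ 2 * m.val := by rw [← h2]; exact hdvd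
  obtain ⟨c, hc⟩ := Nat.dvd_of_mul_dvd_mul_left (by norm_num : 0 < 2) hdvd'
  have hc2 : c < 2 := by
    by_contra h
    have h' : 2 ^ (a + 1) * 2 ≤ 2 ^ (a + 1) * c := Nat.mul_le_mul_left _ (by omega)
    omega
  interval_cases c
  · left
    rw [mul_zero] at hc
    exact (ZMod.val_eq_zero m).1 hc
  · right
    rw [← ZMod.natCast_zmod_val m, hc, mul_one]

/-- **`y^{2^{a+1}} = inr 2^{a+1}` is the unique involution of `C_p ⋊ C_{2^{a+2}}`** (`p` an odd prime).
[cite: Dodson1984, §5.3] -/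
theorem involution_eq (hp : p.Prime) (hp2 : p ≠ 2)
    (g : Multiplicative (ZMod p) ⋊[φ] Multiplicative (ZMod (2 ^ (a + 2)))) (hg : g * g = 1) (hg1 : g ≠ 1) :
    g = SemidirectProduct.inr (Multiplicative.ofAdd ((2 ^ (a + 1) : ℕ) : ZMod (2 ^ (a + 2)))) := by
  obtain ⟨v, m⟩ := g
  have hr : m * m = 1 := by have := congrArg SemidirectProduct.right hg; simpa using this
  have hm : Multiplicative.toAdd m = 0 ∨ Multiplicative.toAdd m = ((2 ^ (a + 1) : ℕ) : ZMod (2 ^ (a + 2))) :=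
    eq_zero_or_eq_of_add_self _ (by rw [← toAdd_mul, hr, toAdd_one])
  have hφm : ∀ w, φ m w = w := fun w => by
    rcases hm with h | h
    · rw [show m = 1 by rw [← ofAdd_toAdd m, h]; rfl, map_one, MulAut.one_apply]
    · have h4 : m = Multiplicative.ofAdd (2 : ZMod (2 ^ (a + 2))) ^ 2 ^ a := by
        rw [← ofAdd_toAdd m, h, ← ofAdd_nsmul, nsmul_eq_mul]
        congr 1
        push_cast
        ring
      rw [h4, phi_two_pow φ hφ]
  have hl : v * v = 1 := by
    have := congrArg SemidirectProduct.left hg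
    simpa [hφm] using this
  have hv : v = 1 := GaloisCyclicSemidirectEight.eq_one_of_mul_self hp hp2 v hl
  subst hv
  rcases hm with h | h
  · exfalso; apply hg1
    have : m = 1 := by rw [← ofAdd_toAdd m, h]; rfl
    subst this; rfl
  · have : m = Multiplicative.ofAdd (((2 ^ (a + 1) : ℕ) : ZMod (2 ^ (a + 2)))) := by rw [← ofAdd_toAdd m, h]
    subst this; rfl

omit hφ in
/-- `|C_p ⋊ C_{2^{a+2}}| = 2^{a+2} p`. [folklore] -/
theorem card_eq [NeZero p] [Fintype (Multiplicative (ZMod p) ⋊[φ] Multiplicative (ZMod (2 ^ (a + 2))))] :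
    Fintype.card (Multiplicative (ZMod p) ⋊[φ] Multiplicative (ZMod (2 ^ (a + 2)))) = 2 ^ (a + 2) * p := by
  haveI : NeZero (2 ^ (a + 2)) := ⟨by positivity⟩
  rw [Fintype.card_congr SemidirectProduct.equivProd, Fintype.card_prod, Fintype.card_multiplicative,
    Fintype.card_multiplicative, ZMod.card, ZMod.card, mul_comm]

end Group

end Summit.HodgeConjecture.CorCM.GaloisCyclicSemidirectTwoPower

end
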